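import Summits.Ventures.CertifiedManyBodySolver.Observables.PairLROOnePointReading
import Literature.MathematicalPhysics.QuantumLattice.HubbardNNNHoppingVariationalWindowCertificate
import HarnessLib

/-!
# One-point route, last link: an OP1-E window CERTIFICATE gives the summit-format pair-LRO ceiling
# `liminf_k u_k ≤ 2M²` and the registry leaf `M3ObsPairLROCeilingAt_tp0 (2M²)`

HONEST FRAMING: first certified bounds on pairing observables; not a superconductivity verdict; every
number certified (two lineages + referee) or labelled float. Crew hubbard-obs (D-0042), seat hubbard-obs-p1
(`prover-hubbard-obs-p1-g5-0`). Zero compute; no definition; no named fact; no `sorry`.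

This file composes the three landed pieces of the source-free one-point route:
* T3′ layer 2 — `re_orbitState_ge_of_window_variational_certificate_d4_TT'_ineq`
  (Literature/…/HubbardNNNHoppingVariationalWindowCertificate, p1 g4): ONE identity in the window algebra
  `𝔄_{Λ'}` — objective `X`, constant `c`, filling rows `μ_σ (n_{0σ} − ν)`, energy row `κ (u − Γ E_Φ)`,
  SOS `Σ Λ_ab O_a† O_b`, affine-`D₄` symmetry defects over a point group `S`, anti-Hermitian parts and
  residual words, and NO stationarity / charged-word terms (tier OP1-E) — bounds `Re ω̄_ζ(Γ(ι_{Λ'}) X)`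
  from below for EVERY unit vector `ζ` of every torus of side `≥ 3` fitting the window;
* the reading step `re_orbitState_spaceGroupUnitary_localPairAt` (PairLROOnePointReading): for
  `X = −Γ(incl) Φ₀^g` and `g` invariant under `S` the right-hand side is `−Re⟨ζ, Δ_g ζ⟩/L²`;
* the finite-volume Koma–Tasaki / KHvdL argument `liminf_pairFieldLRO_le_of_onePoint_orbitState_bound`
  (PairLROOnePointCeiling + Reading): such a one-point bound forces `liminf_k u_k ≤ 2M²`,
  `M = −(c − Σ‖a_k‖ + (Σ_σ μ_σ)(n/2 − ν))`, on the summit's LRO sequence of every family of unit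
  sector ground states, given `κ ≥ 0` and a certified cap `e(t, 0, U, n) ≤ u`.

Results:
* **`liminf_pairFieldLRO_le_of_onePoint_variational_certificate`** — the general statement (`t' = 0`,
  any `t`, `U ≥ 0`, `0 ≤ n < 2`, any form factor `g` invariant under the certificate's point group `S`).
* **`M3ObsPairLROCeilingAt_tp0_of_onePoint_variational_certificate`** — the registry consumer at the M3
  point `(U, n, t') = (8, 7/8, 0)`, `g = g_d`, point group with `b1gSign = 1` (`S ⊆ D₂`): hypotheses =
  {the OP1-E identity `hcert` over `FermionOp Λ'`, `Λm ⪰ 0`, `κ ≥ 0`, cap node `M3EnergyUpperRow 0 hi`,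
  `hi ≤ u`, `2(c − Σ‖a_k‖ + (Σ_σ μ_σ)(7/16 − ν))² ≤ c'`} ⇒ `M3ObsPairLROCeilingAt_tp0 c'` — this is the
  NODE SHAPE for a future `OBS.PhiD1pt` row (the V8/T2 window identity with `s = ∅`, `uu = ∅`, objective
  `−Γ(incl) Φ₀`);
* `stripePointCeiling_of_onePoint_variational_certificate` — thence route item `StripePointCeiling`
  (stmt-HubbardSuperconductivity-9492) when `c' ≤ 1/200` (proof.conditional on the certificate, as every
  certificate consumer). HONEST: no certificate is supplied here; a ceiling, never presence.

References: T. Koma, H. Tasaki, J. Stat. Phys. 76 (1994) 745, Theorem 2.2 [KomaTasaki1994]; J. Wang et al.,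
PRX 14 (2024) 031006, §III [WangEtAl2024]; X. Han, arXiv:2006.06002, §3 [Han2020Bootstrap]; D. J. Scalapino,
Phys. Rep. 250 (1995) 329, §2 eq. (2.4) [Scalapino1995].
-/

noncomputable section

namespace Summit.Ventures.CertifiedManyBodySolver.Observables

open Matrix Complex Finset Literature.MathematicalPhysics.QuantumLattice Literature.Probability.LatticeModels
open Literature.MathematicalPhysics.QuantumLattice.HubbardWave0 ThermodynamicLimit Filter Topology
open Literature.MathematicalPhysics.QuantumManyBody.StateRelaxation
open Summit.Ventures.CertifiedManyBodySolver.Transport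
open scoped ComplexOrder ComplexConjugate BigOperators

section Certificate

variable (g : Site 2 → ℝ)

/-- **OP1-E window certificate ⇒ `liminf_k u_k ≤ 2M²`.** Let `U ≥ 0`, `0 ≤ n < 2`, `κ ≥ 0`,
`e(t, 0, U, n) ≤ u`; `S ∋ 1` a point group closed under multiplication on which the form factor `g` is
invariant; `Λ' ⊇ Λ, thicken {0} 1, pairRegion {0,±e₁,±e₂} 0` a window; and suppose `𝔄_{Λ'}` carries the
variational (OP1-E) identity
`(−Γ(incl) Φ₀^g) − c·1 − Σ_σ μ_σ (n_{0σ} − ν·1) − κ (u·1 − Γ(incl) E^{t,0}_Φ) = Σ Λ_ab O_a† O_b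
  + Σ_l (Γ(incl)(Γ(d4Emb γ_l w_l) Y_l) − Γ(incl) Y_l) + (Σ_m d_m (V_m† − V_m) + Σ_k a_k • v_k)`
with `Λm ⪰ 0`, `γ_l ∈ S`. Then every family of unit `(rectN n L, S^z = 0)`-sector ground states of
`hubbardTorus 2 L t U` has `liminf_k u_k ≤ 2 (c − Σ_k ‖a_k‖ + (Σ_σ μ_σ)(n/2 − ν))²`
(`u_k = |Λ_{2k}|⁻² Σ_{x,y} P_g(2k; x, y)`). [cite: KomaTasaki1994, Theorem 2.2] [cite: WangEtAl2024, §III]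
[cite: Han2020Bootstrap, §3] -/
theorem liminf_pairFieldLRO_le_of_onePoint_variational_certificate (t : ℝ) {U n : ℝ} (hU : 0 ≤ U)
    (hn0 : 0 ≤ n) (hn2 : n < 2) {κ u : ℝ} (hκ : 0 ≤ κ) (hu : energyDensityTT' t 0 U n ≤ u)
    {Λ Λ' : Finset (Site 2)} (hΛ : Λ ⊆ Λ')
    (h0 : thicken ({0} : Finset (Site 2)) 1 ⊆ Λ') (hz : (0 : Site 2) ∈ Λ')
    (hP : pairRegion (insert (0 : Site 2) unitSteps) 0 ⊆ Λ')
    {S : Finset (DihedralGroup 4)} (h1 : (1 : DihedralGroup 4) ∈ S) (hmul : ∀ a ∈ S, ∀ b ∈ S, a * b ∈ S)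
    (hg : ∀ γ ∈ S, ∀ e ∈ insert (0 : Site 2) unitSteps, g (d4Vec γ e) = g e)
    (μ : Fin 2 → ℝ) (ν : ℝ)
    {m : Type*} [Fintype m] [DecidableEq m] {Λm : Matrix m m ℂ} (hΛm : Λm.PosSemidef)
    (O : m → FermionOp Λ')
    {ι : Type*} (tt : Finset ι) (γ : ι → DihedralGroup 4) (hγS : ∀ l ∈ tt, γ l ∈ S) (wv : ι → Site 2)
    (hsh : ∀ l, d4ShiftSet (γ l) (wv l) Λ ⊆ Λ') (Y : ι → FermionOp Λ)
    {δ : Type*} (ah : Finset δ) (dc : δ → ℝ) (V : δ → FermionOp Λ')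
    {κ'' : Type*} (w : Finset κ'') (a : κ'' → ℂ) (word : κ'' → List (Orb (PolySite Λ') × Bool)) {c : ℝ}
    (hcert : -(fermionEmbed (PolySite.incl hP) (localPairAt (insert (0 : Site 2) unitSteps) g 0)) -
        (c : ℂ) • (1 : FermionOp Λ') -
        ∑ σ : Fin 2, ((μ σ : ℝ) : ℂ) • (nAt 0 hz σ - ((ν : ℝ) : ℂ) • (1 : FermionOp Λ')) -
        ((κ : ℝ) : ℂ) • (((u : ℝ) : ℂ) • (1 : FermionOp Λ') -
          fermionEmbed (PolySite.incl h0) ((hubbardTTPrimeFermionInteraction t 0 U).meanEnergyObs 1)) =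
      gramForm Λm O +
        ∑ l ∈ tt, (fermionEmbed (PolySite.incl (hsh l)) (fermionEmbed (PolySite.d4Emb (γ l) (wv l) Λ) (Y l)) -
            fermionEmbed (PolySite.incl hΛ) (Y l)) +
        (∑ m' ∈ ah, ((dc m' : ℝ) : ℂ) • ((V m')ᴴ - V m') + ∑ k ∈ w, a k • ladderWord (word k)))
    (ψ : ∀ L, Fock (Orb (FermionTorus 2 L)))
    (hψ : ∀ L, IsGroundStateInSector (hubbardTorus 2 L t U) (rectN n L) 0 (ψ L))
    (hψ1 : ∀ L, star (ψ L) ⬝ᵥ ψ L = 1) :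
    liminf (fun k : ℕ => (∑ x ∈ halfOpenBox 2 (2 * k), ∑ y ∈ halfOpenBox 2 (2 * k),
        torusPullback (pairFieldCorr g ψ) (2 * k) x y) / ((#(halfOpenBox 2 (2 * k)) : ℝ)) ^ 2) atTop ≤
      2 * (c - ∑ k ∈ w, ‖a k‖ + (∑ σ : Fin 2, μ σ) * (n / 2 - ν)) ^ 2 := by
  -- the window fits into every torus of side `≥ L₀`
  obtain ⟨L₀, hL₀⟩ := exists_forall_le_injOn_proj (d := 2) Λ'
  have hInj : ∀ L : ℕ, max L₀ 3 ≤ L → Set.InjOn (Torus.proj (d := 2) L) ↑Λ' :=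
    fun L hL => hL₀ L (le_trans (le_max_left _ _) hL)
  refine liminf_pairFieldLRO_le_of_onePoint_orbitState_bound g t hU hn0 hn2 μ hκ hu ⟨1, h1⟩ hg hP
    (max L₀ 3) hInj ?_ ψ hψ hψ1
  intro L _ hL ζ hζ
  have hL3 : 3 ≤ L := le_trans (le_max_right _ _) hL
  have h := re_orbitState_ge_of_window_variational_certificate_d4_TT'_ineq t 0 U hL3 hΛ h0 hz (hInj L hL)
    h1 hmul hζ (-(fermionEmbed (PolySite.incl hP) (localPairAt (insert (0 : Site 2) unitSteps) g 0)))
    κ u μ ν hΛm O tt γ hγS wv hsh Y ah dc V w a word hcert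
  rwa [hubbardTorusTT'_zero] at h

/-- **Registry consumer: an OP1-E certificate is ONE theorem application away from the summit-format leaf.**
At the M3 point `(U, n, t') = (8, 7/8, 0)` with `g = g_d`: a point group `S ∋ 1` closed under
multiplication with `b1gSign = 1` on `S` (`S ⊆ D₂`); a window `Λ'` as above; the OP1-E identity `hcert`
for `X = −Γ(incl) Φ₀` with `Λm ⪰ 0`; `κ ≥ 0`; the cap node `M3EnergyUpperRow 0 hi` with `hi ≤ u`; and a
rational `c' ≥ 2 (c − Σ_k ‖a_k‖ + (Σ_σ μ_σ)(7/16 − ν))²`. Then `M3ObsPairLROCeilingAt_tp0 c'`.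
[cite: KomaTasaki1994, Theorem 2.2] [cite: WangEtAl2024, §III] -/
theorem M3ObsPairLROCeilingAt_tp0_of_onePoint_variational_certificate {hi c' : ℚ}
    (hE : M3EnergyUpperRow 0 hi) {κ u : ℝ} (hκ : 0 ≤ κ) (hhi : ((hi : ℚ) : ℝ) ≤ u)
    {Λ Λ' : Finset (Site 2)} (hΛ : Λ ⊆ Λ')
    (h0 : thicken ({0} : Finset (Site 2)) 1 ⊆ Λ') (hz : (0 : Site 2) ∈ Λ')
    (hP : pairRegion (insert (0 : Site 2) unitSteps) 0 ⊆ Λ')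
    {S : Finset (DihedralGroup 4)} (h1 : (1 : DihedralGroup 4) ∈ S) (hmul : ∀ a ∈ S, ∀ b ∈ S, a * b ∈ S)
    (hS1 : ∀ γ ∈ S, b1gSign γ = 1)
    (μ : Fin 2 → ℝ) (ν : ℝ)
    {m : Type*} [Fintype m] [DecidableEq m] {Λm : Matrix m m ℂ} (hΛm : Λm.PosSemidef)
    (O : m → FermionOp Λ')
    {ι : Type*} (tt : Finset ι) (γ : ι → DihedralGroup 4) (hγS : ∀ l ∈ tt, γ l ∈ S) (wv : ι → Site 2)
    (hsh : ∀ l, d4ShiftSet (γ l) (wv l) Λ ⊆ Λ') (Y : ι → FermionOp Λ)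
    {δ : Type*} (ah : Finset δ) (dc : δ → ℝ) (V : δ → FermionOp Λ')
    {κ'' : Type*} (w : Finset κ'') (a : κ'' → ℂ) (word : κ'' → List (Orb (PolySite Λ') × Bool)) {c : ℝ}
    (hcert : -(fermionEmbed (PolySite.incl hP) (localPairAt (insert (0 : Site 2) unitSteps) dWaveFormFactor 0)) -
        (c : ℂ) • (1 : FermionOp Λ') -
        ∑ σ : Fin 2, ((μ σ : ℝ) : ℂ) • (nAt 0 hz σ - ((ν : ℝ) : ℂ) • (1 : FermionOp Λ')) -
        ((κ : ℝ) : ℂ) • (((u : ℝ) : ℂ) • (1 : FermionOp Λ') -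
          fermionEmbed (PolySite.incl h0) ((hubbardTTPrimeFermionInteraction 1 0 8).meanEnergyObs 1)) =
      gramForm Λm O +
        ∑ l ∈ tt, (fermionEmbed (PolySite.incl (hsh l)) (fermionEmbed (PolySite.d4Emb (γ l) (wv l) Λ) (Y l)) -
            fermionEmbed (PolySite.incl hΛ) (Y l)) +
        (∑ m' ∈ ah, ((dc m' : ℝ) : ℂ) • ((V m')ᴴ - V m') + ∑ k ∈ w, a k • ladderWord (word k)))
    (hc' : 2 * (c - ∑ k ∈ w, ‖a k‖ + (∑ σ : Fin 2, μ σ) * ((7 / 8 : ℝ) / 2 - ν)) ^ 2 ≤ ((c' : ℚ) : ℝ)) :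
    M3ObsPairLROCeilingAt_tp0 c' := by
  intro ψ hψ hψ1
  have hu : energyDensityTT' 1 0 8 (7 / 8) ≤ u :=
    (show energyDensityTT' 1 0 8 (7 / 8) ≤ ((hi : ℚ) : ℝ) from hE).trans hhi
  have hψ' : ∀ L, IsGroundStateInSector (hubbardTorus 2 L 1 8) (rectN (7 / 8) L) 0 (ψ L) := fun L => by
    rw [← hubbardTorusTT'_zero]; exact hψ L
  have hg : ∀ γ ∈ S, ∀ e ∈ insert (0 : Site 2) unitSteps, dWaveFormFactor (d4Vec γ e) = dWaveFormFactor e :=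
    fun γ hγ e _ => dWaveFormFactor_d4Vec_of_b1gSign_eq_one (hS1 γ hγ) e
  exact (liminf_pairFieldLRO_le_of_onePoint_variational_certificate dWaveFormFactor 1 (by norm_num)
    (by norm_num) (by norm_num) hκ hu hΛ h0 hz hP h1 hmul hg μ ν hΛm O tt γ hγS wv hsh Y ah dc V w a
    word hcert ψ hψ' hψ1).trans hc'

/-- **Thence the route item `StripePointCeiling`** (stmt-HubbardSuperconductivity-9492) from an OP1-E
certificate with `2 (c − Σ_k ‖a_k‖ + (Σ_σ μ_σ)(7/16 − ν))² ≤ 1/200`. HONEST: no such certificate exists at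
filing time (B0-class relaxations give `2M² ≈ 1.33` [float]). [cite: Scalapino1995, §2 eq. (2.4)] -/
theorem stripePointCeiling_of_onePoint_variational_certificate {hi : ℚ}
    (hE : M3EnergyUpperRow 0 hi) {κ u : ℝ} (hκ : 0 ≤ κ) (hhi : ((hi : ℚ) : ℝ) ≤ u)
    {Λ Λ' : Finset (Site 2)} (hΛ : Λ ⊆ Λ')
    (h0 : thicken ({0} : Finset (Site 2)) 1 ⊆ Λ') (hz : (0 : Site 2) ∈ Λ')
    (hP : pairRegion (insert (0 : Site 2) unitSteps) 0 ⊆ Λ')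
    {S : Finset (DihedralGroup 4)} (h1 : (1 : DihedralGroup 4) ∈ S) (hmul : ∀ a ∈ S, ∀ b ∈ S, a * b ∈ S)
    (hS1 : ∀ γ ∈ S, b1gSign γ = 1)
    (μ : Fin 2 → ℝ) (ν : ℝ)
    {m : Type*} [Fintype m] [DecidableEq m] {Λm : Matrix m m ℂ} (hΛm : Λm.PosSemidef)
    (O : m → FermionOp Λ')
    {ι : Type*} (tt : Finset ι) (γ : ι → DihedralGroup 4) (hγS : ∀ l ∈ tt, γ l ∈ S) (wv : ι → Site 2)
    (hsh : ∀ l, d4ShiftSet (γ l) (wv l) Λ ⊆ Λ') (Y : ι → FermionOp Λ)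
    {δ : Type*} (ah : Finset δ) (dc : δ → ℝ) (V : δ → FermionOp Λ')
    {κ'' : Type*} (w : Finset κ'') (a : κ'' → ℂ) (word : κ'' → List (Orb (PolySite Λ') × Bool)) {c : ℝ}
    (hcert : -(fermionEmbed (PolySite.incl hP) (localPairAt (insert (0 : Site 2) unitSteps) dWaveFormFactor 0)) -
        (c : ℂ) • (1 : FermionOp Λ') -
        ∑ σ : Fin 2, ((μ σ : ℝ) : ℂ) • (nAt 0 hz σ - ((ν : ℝ) : ℂ) • (1 : FermionOp Λ')) -
        ((κ : ℝ) : ℂ) • (((u : ℝ) : ℂ) • (1 : FermionOp Λ') -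
          fermionEmbed (PolySite.incl h0) ((hubbardTTPrimeFermionInteraction 1 0 8).meanEnergyObs 1)) =
      gramForm Λm O +
        ∑ l ∈ tt, (fermionEmbed (PolySite.incl (hsh l)) (fermionEmbed (PolySite.d4Emb (γ l) (wv l) Λ) (Y l)) -
            fermionEmbed (PolySite.incl hΛ) (Y l)) +
        (∑ m' ∈ ah, ((dc m' : ℝ) : ℂ) • ((V m')ᴴ - V m') + ∑ k ∈ w, a k • ladderWord (word k)))
    (hsmall : 2 * (c - ∑ k ∈ w, ‖a k‖ + (∑ σ : Fin 2, μ σ) * ((7 / 8 : ℝ) / 2 - ν)) ^ 2 ≤ 1 / 200) :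
    Summit.HubbardSuperconductivity.HubbardSuperconductivity.Theses.AbsenceCertificate.StripePointCeiling :=
  stripePointCeiling_of_pairLROCeilingAt (c' := 1 / 200)
    (M3ObsPairLROCeilingAt_tp0_of_onePoint_variational_certificate hE hκ hhi hΛ h0 hz hP h1 hmul hS1 μ ν hΛm
      O tt γ hγS wv hsh Y ah dc V w a word hcert (by push_cast; linarith))
    (by push_cast; norm_num)

end Certificate

end Summit.Ventures.CertifiedManyBodySolver.Observables

end
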